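import Summits.QuantumFields.BalabanUV.T4Continuum.Support.ScalarPlantingFaces
import Summits.QuantumFields.BalabanUV.T4Continuum.Support.ScalarSandwichReduction
import Summits.QuantumFields.BalabanUV.Beta.GAN24.DirichletBoxRegularity
import Summits.QuantumFields.BalabanUV.Beta.GAN24.DirichletBoxWindowPoly

/-!
# `BalabanUV.Beta.GAN24.DirichletBoxPairing` — binder row G-an2-4 / (CONV-C), road P2 PART II, module M-P: THE GLOBAL TWO-LEVEL
# PAIRING IDENTITY `J·Δ_k − Δ_{k+1}·J = Σ_μ (A_μ − F_μ)ᴴ∂_μ` ON THE TORUS AND ITS WINDOW BOUND (unit b2b-balaban-gan24-p2, gen 22, v1)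

HONEST FRAMING (cell contract, verbatim): «discharging `BetaPertH` makes Bałaban's UV stability UNCONDITIONAL — a real constructive-QFT
result; it is NOT the continuum limit and NOT the Clay problem.»  SUPPLIER item under the T⁴-DAG sub-row `T4-U1a.S-NE2-D1-DIRICHLET°`
(holder: the t4-ne2-p1 lineage; wall `hinj` = the injected two-level law of the `Ω`-restricted `U = 1` free tower,
[Balaban1985BackgroundPropagators] (3.24) p. 394 «Δ′_a = Δ^η_U + Q′*aQ′ … Δ′_a↾Ω₀ = Ω₀Δ′_aΩ₀»).  Memo
`HOME/b2b-balaban-gan24-p2/gen22/DIRICHLET-BOX-TWOLEVEL.md`, step L2.  The two-level defect of the compressed free propagators is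
`G′J − JG = G′(JD − D′J)G`, and `JD − D′J = J·Δ − Δ′·J` (the unit-block mass terms intertwine EXACTLY, `ScalarPlantingDefect.PiS_mul_JK0`).
THIS FILE computes `J·Δ − Δ′·J` on the tori, for King's 0-form planting `J = JK0 N R M` between `T = (ℤ/NM)^d` and `T′ = (ℤ/RNM)^d`
and the scalar Laplacians `Δ = LapS T N`, `Δ′ = LapS T′ (RN)` of the tree, WITHOUT Fourier analysis:

 * §1 the first-layer indicator `N⁰_μ` of the blocks and the CELL–LINE decomposition (a block = its first `μ`-layer swept by `R − 1` fine
   steps): `Q₀ = Q₀N⁰_μ·Σ_{s<R}S′_μ^s`, `Q₀F⁰_μ = Q₀N⁰_μ·S′_μ^{R−1}` (`F⁰_μ` = far-face indicator of `ScalarPlantingFaces`);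
 * §2 `A_μ := ∂_μJᴴ`, `F_μ := R·JᴴF⁰_μ∂′_μ` and **`pairing_identity`**: `J·Δ − Δ′·J = Σ_μ (A_μ − F_μ)ᴴ·∂_μ` (from `Δ = Σ∂ᴴ∂` and the
   tree's `∂′_μJ = R·F⁰_μJ∂_μ`), **`Aop_sub_Fop_eq`**: `A_μ − F_μ = N√(R^d)·Q₀N⁰_μ·p_R(S′_μ)` with the window polynomial
   `p_R = σ_R(X^R − 1) − R²X^{R−1}(X − 1) = (X − 1)²W_R` of module M-W (`S Q₀ = Q₀S′^R`, `ScalarSandwichReduction.Qavg0_mul_shiftS_pow`);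
 * (companion file `DirichletBoxPairingBound`, §3–§4: the pointwise WINDOW FORMULA `((A_μ − F_μ)v)(y) = cWin·Σ_{j: j_μ=0} Σ_{n<2R−2} w_n·
   (∂′_μᴴ∂′_μ v)(R·y + j + (n+1)e_μ)`, the bound `|((A_μ − F_μ)v)(y)| ≤ (N·√(R^d))⁻¹·Σ_{window} |∂′_μᴴ∂′_μv|`, and the global bound (C-glob)
   `|⟨v,(J·Δ − Δ′·J)u⟩| ≤ (2/N)·Σ_μ ‖∂_μu‖·‖∂′_μᴴ∂′_μv‖` for ALL `u, v` — each fine site lies in at most two windows.)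

ABSOLUTE RULE (cell, verbatim): «No internally-minted statement may enter as a cited fact. Every hypothesis is either kernel-proved in
this package or a verbatim quotation of a PUBLISHED theorem with page reference. The manuscript(s) under audit are NOT citable for
their own disputed steps — they are the thing under adjudication; programme-internal (2001/route/tribunal) claims are never citable.»
Everything here is [folklore] finite lattice calculus on the tree's typed objects; nothing printed is a hypothesis.  NOT CLAIMED: NE2,
the torus rates of `G_k`/`H_k`, (CONV-C) as a whole, `BetaPertH`, continuum, Clay.  «not in print; our proof attempt».
HONEST DEPENDENCY: continuum YM on T⁴ ⇐ BetaPertH ∧ nine spine estimates (0/9 proved); BetaPertH ⇐ (D1) ∧ (D4) ∧ CAP+tail;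
G-an2-4 gates asym, D1 and NE2/3/4.
-/

noncomputable section

open scoped BigOperators ComplexConjugate Matrix Matrix.Norms.L2Operator
open Finset Polynomial

namespace Summit.QuantumFields.BalabanUV.Beta.GAN24.DirichletBoxPairing

open Literature.MathematicalPhysics.QuantumFieldTheory.Balaban1983to89.B5Prop11Plancherel (Tor fine unitVec)
open Literature.MathematicalPhysics.QuantumFieldTheory.Balaban1983to89.B5Action121 (shiftS sdiff LapS shiftS_mulVec sdiff_mulVec
  sdiff_conjTranspose_mulVec star_mulVec_dotProduct dotProduct_mulVec_eq_star_conjTranspose_mulVec)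
open Literature.MathematicalPhysics.QuantumFieldTheory.Balaban1983to89.B5Prop11Lower (nsq nsq_nonneg star_dotProduct_self
  norm_star_dotProduct_le)
open Literature.MathematicalPhysics.QuantumFieldTheory.Balaban1983to89.B5Block118 (tstep tstep_zero tstep_succ)
open Literature.MathematicalPhysics.QuantumFieldTheory.Balaban1983to89.B5G183RateTorus (cpt)
open Literature.MathematicalPhysics.QuantumFieldTheory.Balaban1983to89.B5G183RateTorusW (off)
open Summit.QuantumFields.BalabanUV.T4Continuum
open Summit.QuantumFields.BalabanUV.T4Continuum.BalabanAveragedTowerModes (par rem par_cpt_add_off rem_cpt_add_off val_cpt_add_off)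
open Summit.QuantumFields.BalabanUV.T4Continuum.BalabanBlockPoincare (tileEquiv)
open Summit.QuantumFields.BalabanUV.T4Continuum.ScalarMassTower (cpt_add_unitVec)
open Summit.QuantumFields.BalabanUV.T4Continuum.ScalarBlockPlanting (Qavg0 JK0 Qavg0_mul_apply sum_fine_eq_sum_tile star_Qavg0_apply)
open Summit.QuantumFields.BalabanUV.T4Continuum.ScalarPlantingFaces (faceF0 sdiff_mul_JK0)
open Summit.QuantumFields.BalabanUV.T4Continuum.ScalarSandwichReduction (Qavg0_mul_shiftS_pow shiftS_mul_apply shiftS_pow_mul_apply)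
open Summit.QuantumFields.BalabanUV.Beta.GAN24.DirichletBoxRegularity (Pdir Pdir_mulVec)
open Summit.QuantumFields.BalabanUV.Beta.GAN24.DirichletBoxWindowPoly (sig ppoly wpoly ppoly_eq wpoly_eq_sum norm_coeff_wpoly_le)

variable {d : ℕ} (N R : ℕ) [NeZero N] [NeZero R] (M : Fin d → ℕ) [hM : ∀ μ, NeZero (M μ)]

/-! ## §1 First layers, faces, and the cell–line decomposition -/

/-- the diagonal indicator `N⁰_μ` of the FIRST `μ`-layer of the `R`-blocks of `T′` (fine sites with `μ`-offset `0`, `R ∣ x′_μ`). [folklore] -/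
def firstL (μ : Fin d) : Matrix (Tor (fine (R * N) M)) (Tor (fine (R * N) M)) ℂ :=
  Matrix.diagonal fun x => if R ∣ (x μ).val then 1 else 0

omit [NeZero R] in
/-- the offset decides the first layer: `R ∣ (R·y + j)_μ ↔ j_μ = 0`. [folklore] -/
theorem first_cpt_add_off_iff (μ : Fin d) (y : Tor (fine N M)) (j : Fin d → Fin R) :
    R ∣ ((cpt N R M y + off N R M j) μ).val ↔ (j μ : ℕ) = 0 := by
  rw [Nat.dvd_iff_mod_eq_zero, val_cpt_add_off, Nat.mul_add_mod, Nat.mod_eq_of_lt (j μ).isLt]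

/-- the offset decides the far face: `R ∣ (R·y + j)_μ + 1 ↔ j_μ = R − 1`. [folklore] -/
theorem face_cpt_add_off_iff' (μ : Fin d) (y : Tor (fine N M)) (j : Fin d → Fin R) :
    R ∣ ((cpt N R M y + off N R M j) μ).val + 1 ↔ (j μ : ℕ) = R - 1 := by
  rw [BlockPairingGeometry.face_cpt_add_off_iff]
  have hj := (j μ).isLt
  constructor
  · intro h
    obtain ⟨c, hc⟩ := h
    have hc1 : c = 1 := by
      rcases Nat.lt_or_ge c 2 with h2 | h2
      · interval_cases c
        · omega
        · rfl
      · nlinarith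
    subst hc1
    omega
  · intro h
    exact ⟨1, by omega⟩

omit [NeZero N] [NeZero R] hM in
/-- moving `s` fine steps along `μ` inside a block from its first layer: `off j + s·e_μ = off (j[μ ↦ s])` when `j_μ = 0`. [folklore] -/
theorem off_add_tstep_eq (μ : Fin d) {j : Fin d → Fin R} (hj : (j μ : ℕ) = 0) (s : Fin R) :
    off N R M j + tstep (fine (R * N) M) μ (s : ℕ) = off N R M (Function.update j μ s) := by
  funext ν
  by_cases h : ν = μ
  · subst h
    simp [off, tstep, hj]
  · simp [off, tstep, h]

/-- fibring the offsets over their `μ`-component: `Σ_j G(j) = Σ_{s<R} Σ_{j: j_μ=0} G(j[μ ↦ s])`. [folklore] -/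
theorem sum_update_layers {β : Type*} [AddCommMonoid β] (μ : Fin d) (G : (Fin d → Fin R) → β) :
    ∑ j : Fin d → Fin R, G j
      = ∑ s : Fin R, ∑ j ∈ univ.filter (fun j : Fin d → Fin R => (j μ : ℕ) = 0), G (Function.update j μ s) := by
  -- fibre the left sum over the value of `j μ`
  rw [← Finset.sum_fiberwise_of_maps_to (s := (univ : Finset (Fin d → Fin R))) (t := (univ : Finset (Fin R)))
    (g := fun j => j μ) (fun _ _ => Finset.mem_univ _)]
  refine Finset.sum_congr rfl fun s _ => ?_
  -- the fibre `{j | j μ = s}` is the image of `{j | j μ = 0}` under `j ↦ j[μ ↦ s]`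
  refine Finset.sum_nbij' (fun j => Function.update j μ 0) (fun j => Function.update j μ s) ?_ ?_ ?_ ?_ ?_
  · intro j hj
    simp
  · intro j hj
    simp
  · intro j hj
    have hj' : j μ = s := by simpa using hj
    funext ν
    by_cases h : ν = μ
    · subst h; simp [hj']
    · simp [h]
  · intro j hj
    have hj' : (j μ : ℕ) = 0 := by simpa using hj
    funext ν
    by_cases h : ν = μ
    · subst h; apply Fin.ext; simp [hj']
    · simp [h]
  · intro j hj
    have hj' : j μ = s := by simpa using hj
    congr 1
    funext ν
    by_cases h : ν = μ
    · subst h; simp [hj']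
    · simp [h]

omit [NeZero N] hM in
/-- **THE CELL–LINE DECOMPOSITION of a sum over a block**: `Σ_{j} g(R·y + j) = Σ_{s<R} Σ_{j: j_μ=0} g(R·y + j + s·e_μ)`. [folklore] -/
theorem sum_block_eq_sum_layers {β : Type*} [AddCommMonoid β] (μ : Fin d) (y : Tor (fine N M)) (g : Tor (fine (R * N) M) → β) :
    ∑ j : Fin d → Fin R, g (cpt N R M y + off N R M j)
      = ∑ s : Fin R, ∑ j ∈ univ.filter (fun j : Fin d → Fin R => (j μ : ℕ) = 0),
          g (cpt N R M y + off N R M j + tstep (fine (R * N) M) μ (s : ℕ)) := by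
  rw [sum_update_layers R μ]
  refine Finset.sum_congr rfl fun s _ => Finset.sum_congr rfl fun j hj => ?_
  have hj' : (j μ : ℕ) = 0 := by simpa using hj
  rw [add_assoc, off_add_tstep_eq N R M μ hj' s]

/-- rows of `Q₀N⁰_μ S′_μ^s X`: first-layer samples moved `s` steps. [folklore] -/
theorem Qavg0_firstL_shiftS_pow_mul_apply {β : Type*} (μ : Fin d) (s : ℕ) (X : Matrix (Tor (fine (R * N) M)) β ℂ)
    (y : Tor (fine N M)) (b : β) :
    (Qavg0 N R M * firstL N R M μ * shiftS (fine (R * N) M) μ ^ s * X) y b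
      = ((R : ℂ) ^ d)⁻¹ * ∑ j ∈ univ.filter (fun j : Fin d → Fin R => (j μ : ℕ) = 0),
          X (cpt N R M y + off N R M j + tstep (fine (R * N) M) μ s) b := by
  rw [Matrix.mul_assoc, Matrix.mul_assoc, Qavg0_mul_apply]
  congr 1
  rw [Finset.sum_filter]
  refine Finset.sum_congr rfl fun j _ => ?_
  rw [firstL, Matrix.diagonal_mul, shiftS_pow_mul_apply]
  by_cases h : (j μ : ℕ) = 0
  · rw [if_pos ((first_cpt_add_off_iff N R M μ y j).mpr h), one_mul, if_pos h]
  · rw [if_neg (fun h' => h ((first_cpt_add_off_iff N R M μ y j).mp h')), zero_mul, if_neg h]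

/-- **`Q₀ = Q₀N⁰_μ·Σ_{s<R} S′_μ^s`** (a block is its first `μ`-layer swept forward `R − 1` steps). [folklore] -/
theorem Qavg0_eq_firstL_sum (μ : Fin d) :
    Qavg0 N R M = Qavg0 N R M * firstL N R M μ * ∑ s ∈ range R, shiftS (fine (R * N) M) μ ^ s := by
  have key : ∀ X : Matrix (Tor (fine (R * N) M)) (Tor (fine (R * N) M)) ℂ,
      Qavg0 N R M * X = Qavg0 N R M * firstL N R M μ * (∑ s ∈ range R, shiftS (fine (R * N) M) μ ^ s) * X := by
    intro X
    ext y b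
    have hsplit := sum_block_eq_sum_layers N R M μ y (fun z => X z b)
    rw [Qavg0_mul_apply, Matrix.mul_assoc, Finset.sum_mul, Matrix.mul_sum, Matrix.sum_apply,
      hsplit, Finset.mul_sum, ← Fin.sum_univ_eq_sum_range]
    refine Finset.sum_congr rfl fun s _ => ?_
    rw [← Matrix.mul_assoc, Qavg0_firstL_shiftS_pow_mul_apply]
  simpa only [Matrix.mul_one] using key 1

/-- **`Q₀F⁰_μ = Q₀N⁰_μ·S′_μ^{R−1}`** (the far face is the first layer moved `R − 1` steps). [folklore] -/
theorem Qavg0_mul_faceF0 (μ : Fin d) :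
    Qavg0 N R M * faceF0 N R M μ = Qavg0 N R M * firstL N R M μ * shiftS (fine (R * N) M) μ ^ (R - 1) := by
  have hR : 0 < R := Nat.pos_of_ne_zero (NeZero.ne R)
  have key : ∀ X : Matrix (Tor (fine (R * N) M)) (Tor (fine (R * N) M)) ℂ,
      Qavg0 N R M * faceF0 N R M μ * X = Qavg0 N R M * firstL N R M μ * shiftS (fine (R * N) M) μ ^ (R - 1) * X := by
    intro X
    ext y b
    rw [Qavg0_firstL_shiftS_pow_mul_apply, Matrix.mul_assoc, Qavg0_mul_apply]
    congr 1
    -- only the far-face offsets `j_μ = R − 1` survive on the left; reindex them by the first layer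
    have hsplit := sum_block_eq_sum_layers N R M μ y (fun z => (faceF0 N R M μ * X) z b)
    rw [hsplit]
    rw [Finset.sum_eq_single (⟨R - 1, by omega⟩ : Fin R)]
    · refine Finset.sum_congr rfl fun j hj => ?_
      have hj' : (j μ : ℕ) = 0 := by simpa using hj
      have hface : R ∣ ((cpt N R M y + off N R M j + tstep (fine (R * N) M) μ ((⟨R - 1, by omega⟩ : Fin R) : ℕ)) μ).val + 1 := by
        rw [add_assoc, off_add_tstep_eq N R M μ hj', face_cpt_add_off_iff']
        simp
      rw [faceF0, Matrix.diagonal_mul, if_pos hface, one_mul]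
    · intro s _ hs
      refine Finset.sum_eq_zero fun j hj => ?_
      have hj' : (j μ : ℕ) = 0 := by simpa using hj
      have hface : ¬ R ∣ ((cpt N R M y + off N R M j + tstep (fine (R * N) M) μ (s : ℕ)) μ).val + 1 := by
        rw [add_assoc, off_add_tstep_eq N R M μ hj', face_cpt_add_off_iff']
        intro h
        apply hs
        apply Fin.ext
        simpa using h
      rw [faceF0, Matrix.diagonal_mul, if_neg hface, zero_mul]
    · intro h; exact absurd (Finset.mem_univ _) h
  simpa only [Matrix.mul_one] using key 1

/-! ## §2 `A_μ`, `F_μ`, the pairing identity, and the window polynomial in the fine translation -/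

/-- `A_μ := ∂_μ·J₀ᴴ` — the coarse difference of the (isometrically normalised) block sums. [folklore] -/
def Aop (μ : Fin d) : Matrix (Tor (fine N M)) (Tor (fine (R * N) M)) ℂ :=
  sdiff (fine N M) (N : ℂ) μ * (JK0 N R M)ᴴ

/-- `F_μ := R·J₀ᴴ·F⁰_μ·∂′_μ` — the (normalised) sum of the fine differences across the far `μ`-face of each block. [folklore] -/
def Fop (μ : Fin d) : Matrix (Tor (fine N M)) (Tor (fine (R * N) M)) ℂ :=
  (R : ℂ) • ((JK0 N R M)ᴴ * faceF0 N R M μ * sdiff (fine (R * N) M) ((R * N : ℕ) : ℂ) μ)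

omit [NeZero N] [NeZero R] hM in
/-- `F⁰_μ` is a real diagonal matrix. [folklore] -/
theorem faceF0_conjTranspose (μ : Fin d) : (faceF0 N R M μ)ᴴ = faceF0 N R M μ := by
  rw [faceF0, Matrix.diagonal_conjTranspose]
  congr 1
  funext x
  by_cases h : R ∣ (x μ).val + 1 <;> simp [h]

/-- `F_μᴴ·∂_μ = ∂′_μᴴ∂′_μ·J₀` (from the tree's `∂′_μJ₀ = R·F⁰_μJ₀∂_μ`). [folklore] -/
theorem Fop_conjTranspose_mul_sdiff (hN : 1 ≤ N) (μ : Fin d) :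
    (Fop N R M μ)ᴴ * sdiff (fine N M) (N : ℂ) μ
      = (sdiff (fine (R * N) M) ((R * N : ℕ) : ℂ) μ)ᴴ * sdiff (fine (R * N) M) ((R * N : ℕ) : ℂ) μ * JK0 N R M := by
  rw [Fop, Matrix.conjTranspose_smul, Matrix.conjTranspose_mul, Matrix.conjTranspose_mul, Matrix.conjTranspose_conjTranspose,
    faceF0_conjTranspose, Matrix.mul_assoc _ _ (JK0 N R M), sdiff_mul_JK0 N R M hN μ, Matrix.mul_smul, Matrix.smul_mul]
  congr 1
  · simp
  · simp only [Matrix.mul_assoc]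

/-- **THE PAIRING IDENTITY** `J₀·Δ − Δ′·J₀ = Σ_μ (A_μ − F_μ)ᴴ·∂_μ`. [folklore] -/
theorem pairing_identity (hN : 1 ≤ N) :
    JK0 N R M * LapS (fine N M) (N : ℂ) - LapS (fine (R * N) M) ((R * N : ℕ) : ℂ) * JK0 N R M
      = ∑ μ, (Aop N R M μ - Fop N R M μ)ᴴ * sdiff (fine N M) (N : ℂ) μ := by
  rw [LapS, LapS, Matrix.mul_sum, Matrix.sum_mul, ← Finset.sum_sub_distrib]
  refine Finset.sum_congr rfl fun μ _ => ?_
  rw [Matrix.conjTranspose_sub, Matrix.sub_mul, Fop_conjTranspose_mul_sdiff N R M hN, Aop, Matrix.conjTranspose_mul,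
    Matrix.conjTranspose_conjTranspose]
  simp only [Matrix.mul_assoc]

/-- the scalar `N·√(R^d)` of the factorisation. [folklore] -/
def cAF (d N R : ℕ) : ℂ := (N : ℂ) * (((Real.sqrt ((R : ℝ) ^ d)) : ℝ) : ℂ)

/-- `‖N·√(R^d)‖ = N·√(R^d)`. [folklore] -/
theorem norm_cAF (d N R : ℕ) : ‖cAF d N R‖ = (N : ℝ) * Real.sqrt ((R : ℝ) ^ d) := by
  rw [cAF, norm_mul, Complex.norm_natCast, Complex.norm_real, Real.norm_of_nonneg (Real.sqrt_nonneg _)]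

/-- `A_μ = N√(R^d)·Q₀·(S′_μ^R − 1)` (`S·Q₀ = Q₀·S′^R`). [folklore] -/
theorem Aop_eq (μ : Fin d) : Aop N R M μ = cAF d N R • (Qavg0 N R M * (shiftS (fine (R * N) M) μ ^ R - 1)) := by
  obtain ⟨hs, -⟩ := KingPairingPlantedLaw.sqrt_facts (d := d) R
  have e : sdiff (fine N M) (N : ℂ) μ = (N : ℂ) • (shiftS (fine N M) μ - 1) := rfl
  rw [Aop, JK0, Matrix.conjTranspose_smul, Matrix.conjTranspose_conjTranspose, hs, e, Matrix.smul_mul, Matrix.mul_smul,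
    smul_smul, Matrix.sub_mul, Matrix.one_mul, ← Qavg0_mul_shiftS_pow, Matrix.mul_sub, Matrix.mul_one, cAF]

/-- `F_μ = N√(R^d)·R²·Q₀N⁰_μ·S′_μ^{R−1}·(S′_μ − 1)`. [folklore] -/
theorem Fop_eq (μ : Fin d) :
    Fop N R M μ = cAF d N R • (((R : ℂ) ^ 2) •
      (Qavg0 N R M * firstL N R M μ * shiftS (fine (R * N) M) μ ^ (R - 1) * (shiftS (fine (R * N) M) μ - 1))) := by
  obtain ⟨hs, -⟩ := KingPairingPlantedLaw.sqrt_facts (d := d) R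
  have e : sdiff (fine (R * N) M) ((R * N : ℕ) : ℂ) μ = ((R * N : ℕ) : ℂ) • (shiftS (fine (R * N) M) μ - 1) := rfl
  rw [Fop, JK0, Matrix.conjTranspose_smul, Matrix.conjTranspose_conjTranspose, hs, Matrix.smul_mul, Matrix.smul_mul,
    Qavg0_mul_faceF0, e, Matrix.mul_smul, smul_smul, smul_smul, smul_smul, cAF]
  congr 1
  push_cast
  ring

/-- the window polynomial evaluated in the fine translation:
`p_R(S′) = (Σ_{s<R}S′^s)(S′^R − 1) − R²·S′^{R−1}(S′ − 1)`. [folklore] -/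
theorem aeval_ppoly (μ : Fin d) :
    Polynomial.aeval (shiftS (fine (R * N) M) μ) (ppoly R)
      = (∑ s ∈ range R, shiftS (fine (R * N) M) μ ^ s) * (shiftS (fine (R * N) M) μ ^ R - 1)
        - ((R : ℂ) ^ 2) • (shiftS (fine (R * N) M) μ ^ (R - 1) * (shiftS (fine (R * N) M) μ - 1)) := by
  rw [ppoly, sig]
  simp only [map_sub, map_mul, map_sum, Polynomial.aeval_C, Algebra.algebraMap_eq_smul_one]
  simp only [map_pow, Polynomial.aeval_X, map_one, smul_mul_assoc, one_mul]

/-- **`A_μ − F_μ = N√(R^d)·Q₀N⁰_μ·p_R(S′_μ)`.** [folklore] -/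
theorem Aop_sub_Fop_eq (μ : Fin d) :
    Aop N R M μ - Fop N R M μ
      = cAF d N R • (Qavg0 N R M * firstL N R M μ * Polynomial.aeval (shiftS (fine (R * N) M) μ) (ppoly R)) := by
  have hA : Aop N R M μ = cAF d N R • (Qavg0 N R M * firstL N R M μ * (∑ s ∈ range R, shiftS (fine (R * N) M) μ ^ s)
      * (shiftS (fine (R * N) M) μ ^ R - 1)) := by
    rw [Aop_eq, ← Qavg0_eq_firstL_sum]
  rw [hA, Fop_eq, aeval_ppoly, ← smul_sub]
  congr 1
  conv_rhs => rw [Matrix.mul_sub, Matrix.mul_smul]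
  simp only [Matrix.mul_assoc]

end Summit.QuantumFields.BalabanUV.Beta.GAN24.DirichletBoxPairing

end
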